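import Summits.BirchSwinnertonDyer.BirchSwinnertonDyer.Theses.ErratumRoadFive
import Summits.BirchSwinnertonDyer.BirchSwinnertonDyer.Theorems.ErratumRoadFiveKatoFframeValueAtomsOfFamily
import HarnessLib

/-!
# Route `ErratumRoadFive`, crux `EulerHalfNotRamNoInertSetAtFive` (stmt-BirchSwinnertonDyer-19715), line `kato_Fframe` r5.6 —
# **crux 19715 BY NAME ⟸ SEVEN named Literature facts + the two FAMILY-LEVEL valuation inequalities (research, stated on the
# bottom class of the Λ-adic lift of a value-pinned Kato family with Kato's printed constants), nothing else**

LEAD seat `bsd-line-er5-p1` (g12), `--supports stmt-BirchSwinnertonDyer-19715`; one theorem (no definition, no named fact, no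
instance, no notation, no `sorry`). The crux-named corollary of the ROUTE-INDEPENDENT module
`ErratumRoadFiveKatoFframeValueAtomsOfFamily` (this seat): compared with `ErratumRoadFiveKatoFframeClosureOfPrint` (p768192, «∀ admissible
z₀» research binders `hVsplit` / `hVnonsplit`), the two research binders are now FAMILY-LEVEL (`hFamSplit` / `hFamNonsplit`): one
valuation inequality for every non-zero Kummer logarithm of the bottom class `Cor_{ℚ(μ_p)/ℚ} z_{p,∅}` of the lift `y ∈ 𝐇¹_Γ` of a
value-pinned Kato family `(f, ι, q, Λ, c, d₁, a, A, d′; z, x)`, with the explicit shift `v_p(λ/(q·R⁻_𝟙·∏_{ℓ∣A,ℓ≠p}P_ℓ(ℓ⁻¹)))`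
(`λ = Ω⁺_f/Ω_W`) — no admissibility predicate, no `Λˣ`-ambiguity (transfer p768925). This file imports the route file and the
route-independent engine only (theses-cone hygiene).

HONEST FRAMING: CONDITIONAL (seven named-fact hypotheses + two family-level research binders); the crux's three residual hypotheses
(`¬Ram`, `p ∣ ∏c`, «no inert-set datum») are idle, as in every closure of this line; closes nothing; credits no registered stub. No
summit statement is proved; BSD is proved for no curve.

References: [Kato2004Asterisque] Thm. 12.4 (3), Thm. 12.5 (1), (4) (pp. 221–222), Ex. 13.3 (p. 225), (14.9.3), (14.14.2);
[Venerucci2016] Thm. A, Thm. B; [BertoliniDarmonVenerucci2022] Thm. A; [Kim2022] Thm. 2.1, Cor. 2.3; [GrossZagier1986] Thm. I.(7.3);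
[Darmon2004] Thm. 3.22; [PerrinRiou1993AIF] §3.3.
-/

-- the summit and its single problem are both named `BirchSwinnertonDyer` (registry layout D-0017)
set_option linter.dupNamespace false
set_option autoImplicit false

noncomputable section

open scoped BigOperators NumberField TensorProduct Classical
open Field IsDedekindDomain NumberField CongruenceSubgroup ValuativeRel WeierstrassCurve
open Literature.NumberTheory.GaloisRepresentations
open Literature.NumberTheory.GaloisRepresentations.PeriodRingData
open Literature.NumberTheory.GaloisRepresentations.IsNonarchimedeanLocalField
open Literature.NumberTheory.PAdicHodge
open Literature.NumberTheory.EllipticCurves Literature.NumberTheory.EllipticCurves.ModularForms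
open Literature.NumberTheory.EllipticCurves.Kato2004 Literature.NumberTheory.EllipticCurves.Kato2004.EulerSystemValues
open Literature.NumberTheory.EllipticCurves.Rank1Residual Literature.NumberTheory.EllipticCurves.Rank1Residual.Typed
open Literature.NumberTheory.AdelicBaseChange Literature.NumberTheory.Automorphic
open Summit.BirchSwinnertonDyer.Rank1Residual Summit.BirchSwinnertonDyer.Rank1Residual.Additive
open Summit.BirchSwinnertonDyer.BirchSwinnertonDyer.Theses.ErratumRoadFive

namespace Summit.BirchSwinnertonDyer.BirchSwinnertonDyer.Theorems.ErratumRoadFiveKatoFframeClosureOfFamily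

/-- **Crux 19715 `ErratumRoadFive.EulerHalfNotRamNoInertSetAtFive` BY NAME from SEVEN named facts {GZK, Kato 12.5 (4) realisability,
F1′, H2Xʳ, GZ86 I.(7.3), Venerucci 2016, BDV 2022} and the two FAMILY-LEVEL research valuation inequalities `hFamSplit` / `hFamNonsplit`**
(its three residual hypotheses are idle). Proof: `ErratumRoadFiveKatoFframeValueAtomsOfFamily.missingUpperBoundAt_of_printedFacts_of_familyInequalities`.
CONDITIONAL; closes nothing. [cite: Kato2004Asterisque, Thm. 12.5 (1), (4) (pp. 221–222), Ex. 13.3 (p. 225)] [cite: Venerucci2016, Thm. A and Thm. B]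
[cite: BertoliniDarmonVenerucci2022, Thm. A] [cite: GrossZagier1986, Thm. I.(7.3)] [cite: Darmon2004, Thm. 3.22] [cite: PerrinRiou1993AIF, §3.3] -/
theorem eulerHalfNotRamNoInertSetAtFive_of_printedFacts_of_familyInequalities
    (hGZK : rank_eq_analyticRank_of_analyticRank_le_one)
    (hReal : exists_isAdmissibleZetaClass_of_imageContainsSL2)
    (hF1 : lengthAt_fineSelmerDual_le_of_isAdmissibleZetaClass)
    (hH2X : exists_iwasawaH2Data_fineSelmerDual_embedding_countRankFree)
    (hGZ : GrossZagier1986_thm_I_7_3)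
    (hV : Venerucci2016_kummerLog_bottomLayer_ne_zero_split)
    (hB : BertoliniDarmonVenerucci2022_kummerLog_bottomLayer_ne_zero)
    (hFamSplit : ∀ (W : WeierstrassCurve ℚ) [W.IsElliptic] [W.IsGloballyMinimal] (p : ℕ) [Fact p.Prime]
      [ContinuousSMul ℤ_[p] (W.tateModule p)] [Module.Free ℤ_[p] (W.tateModule p)] [Module.Finite ℤ_[p] (W.tateModule p)],
      ClassX11b W p → 5 ≤ p → Surj W p → W.HasSplitMultiplicativeReductionAtPrime p →
      ∀ (h1 : W.mordellWeilRank = 1) (P : Fin W.mordellWeilRank → W.toAffine.Point),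
        W.IsMordellWeilBasis P →
      ∀ (K : ZpExtension ℚ p) (hK : K.IsCyclotomic) (γ : absoluteGaloisGroup ℚ)
        (I : IwasawaH1Data W p K γ), K.IsTopGenerator γ →
      ∀ (hp : p ≠ 2) (N : ℕ) [NeZero N] (f : CuspForm (Gamma0 N) 2), IsNewformOf W f →
      ∀ (ι : (n : ℕ) → (CyclotomicField n ℚ →+* ℂ)) (q : ℚ)
        (Λ : ∀ (k : ℕ) (r : Finset (HeightOneSpectrum (𝓞 ℚ))),
          H1 (tateRep W p) (cycSubgroup p k r) →ₗ[ℤ_[p]] ℚ_[p] ⊗[ℚ] CyclotomicField (cycLevel p k r) ℚ)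
        (c d₁ a : ℤ) (A : ℕ) (d' : ℤ)
        (z : ∀ (k : ℕ) (r : (cyclotomicLevelsRat p (badPlaces c d₁ A N)).Ideals),
          H1 (tateRep W p) ((cyclotomicLevelsRat p (badPlaces c d₁ A N)).level k r.1))
        (x : ∀ (k : ℕ) (r : (cyclotomicLevelsRat p (badPlaces c d₁ A N)).Ideals),
          CyclotomicField (cycLevel p k r.1) ℚ)
        (y : I.H) (perRatio : ℚ),
        q ≠ 0 → ZetaBody W p f ι ((q : ℚ) : ℝ) Λ c d₁ a A z x →
        (∀ n : ℕ, I.proj n y =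
          levelToLayer W p hK hp (badPlaces c d₁ A N) n
            (z (n + 1) (cyclotomicLevelsRat p (badPlaces c d₁ A N)).idealOne)) →
        0 < A → Int.gcd c (6 * p * A) = 1 → Int.gcd d₁ (6 * p * N) = 1 → (d₁ : ℤ) * d' ≡ 1 [ZMOD (A : ℤ)] →
        ratCuspFactor f true c d₁ a A d' ≠ 0 → perRatio ≠ 0 →
        plusPeriod f = ((perRatio : ℚ) : ℝ) * W.realPeriodRat →
      ∀ s : ℚ_[p], HasLocPKummerLog W p (layerZeroToTop W p K (I.proj 0 y)) s → s ≠ 0 →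
      ∀ qSha : ℚ, shaAn W = (qSha : ℂ) →
        s.valuation +
              padicValRat p (perRatio /
                (q * ratCuspFactor f true c d₁ a A d' * ∏ ℓ ∈ A.primeFactors.erase p, eulerFactorAtOne W N ℓ)) -
            2 * (padicLogLocal W p (WeierstrassCurve.Affine.Point.map (Algebra.ofId ℚ ℚ_[p]) (P (Fin.cast h1.symm 0)))).valuation ≤
          padicValRat p qSha + padicValNat p W.tamagawaProduct - 2 * padicValNat p W.torsionOrder - 1)
    (hFamNonsplit : ∀ (W : WeierstrassCurve ℚ) [W.IsElliptic] [W.IsGloballyMinimal] (p : ℕ) [Fact p.Prime]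
      [ContinuousSMul ℤ_[p] (W.tateModule p)] [Module.Free ℤ_[p] (W.tateModule p)] [Module.Finite ℤ_[p] (W.tateModule p)],
      ClassX11b W p → 5 ≤ p → Surj W p → ¬ W.HasSplitMultiplicativeReductionAtPrime p →
      ∀ (h1 : W.mordellWeilRank = 1) (P : Fin W.mordellWeilRank → W.toAffine.Point),
        W.IsMordellWeilBasis P →
      ∀ (K : ZpExtension ℚ p) (hK : K.IsCyclotomic) (γ : absoluteGaloisGroup ℚ)
        (I : IwasawaH1Data W p K γ), K.IsTopGenerator γ →
      ∀ (hp : p ≠ 2) (N : ℕ) [NeZero N] (f : CuspForm (Gamma0 N) 2), IsNewformOf W f →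
      ∀ (ι : (n : ℕ) → (CyclotomicField n ℚ →+* ℂ)) (q : ℚ)
        (Λ : ∀ (k : ℕ) (r : Finset (HeightOneSpectrum (𝓞 ℚ))),
          H1 (tateRep W p) (cycSubgroup p k r) →ₗ[ℤ_[p]] ℚ_[p] ⊗[ℚ] CyclotomicField (cycLevel p k r) ℚ)
        (c d₁ a : ℤ) (A : ℕ) (d' : ℤ)
        (z : ∀ (k : ℕ) (r : (cyclotomicLevelsRat p (badPlaces c d₁ A N)).Ideals),
          H1 (tateRep W p) ((cyclotomicLevelsRat p (badPlaces c d₁ A N)).level k r.1))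
        (x : ∀ (k : ℕ) (r : (cyclotomicLevelsRat p (badPlaces c d₁ A N)).Ideals),
          CyclotomicField (cycLevel p k r.1) ℚ)
        (y : I.H) (perRatio : ℚ),
        q ≠ 0 → ZetaBody W p f ι ((q : ℚ) : ℝ) Λ c d₁ a A z x →
        (∀ n : ℕ, I.proj n y =
          levelToLayer W p hK hp (badPlaces c d₁ A N) n
            (z (n + 1) (cyclotomicLevelsRat p (badPlaces c d₁ A N)).idealOne)) →
        0 < A → Int.gcd c (6 * p * A) = 1 → Int.gcd d₁ (6 * p * N) = 1 → (d₁ : ℤ) * d' ≡ 1 [ZMOD (A : ℤ)] →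
        ratCuspFactor f true c d₁ a A d' ≠ 0 → perRatio ≠ 0 →
        plusPeriod f = ((perRatio : ℚ) : ℝ) * W.realPeriodRat →
      ∀ s : ℚ_[p], HasLocPKummerLog W p (layerZeroToTop W p K (I.proj 0 y)) s → s ≠ 0 →
      ∀ qSha : ℚ, shaAn W = (qSha : ℂ) →
        s.valuation +
              padicValRat p (perRatio /
                (q * ratCuspFactor f true c d₁ a A d' * ∏ ℓ ∈ A.primeFactors.erase p, eulerFactorAtOne W N ℓ)) -
            2 * (padicLogLocal W p (WeierstrassCurve.Affine.Point.map (Algebra.ofId ℚ ℚ_[p]) (P (Fin.cast h1.symm 0)))).valuation ≤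
          padicValRat p qSha + padicValNat p W.tamagawaProduct - 2 * padicValNat p W.torsionOrder - 1) :
    EulerHalfNotRamNoInertSetAtFive := by
  intro W _ _ p _ hX h5 hSurj _hnRam _hTam _hNoS
  exact ErratumRoadFiveKatoFframeValueAtomsOfFamily.missingUpperBoundAt_of_printedFacts_of_familyInequalities
    hGZK hReal hF1 hH2X hGZ hV hB hFamSplit hFamNonsplit W p hX h5 hSurj

end Summit.BirchSwinnertonDyer.BirchSwinnertonDyer.Theorems.ErratumRoadFiveKatoFframeClosureOfFamily

end
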